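import Mathlib.NumberTheory.Padics.PadicNumbers
import Mathlib.NumberTheory.Padics.PadicVal.Basic
import Mathlib.Data.Nat.Factorization.Basic
import Mathlib.Analysis.InnerProductSpace.l2Space
import Mathlib.MeasureTheory.Function.LpSeminorm.Indicator
import Literature.NumberTheory.ConnesConsani.AdeleClassTraceFormula
import Literature.NumberTheory.ConnesConsani2021.SemilocalSoninSpace
import Literature.NumberTheory.ConnesConsani2021.ScalingOperator
import Literature.NumberTheory.ConnesConsani2024.KnotsPrimesSemilocal
import Literature.NumberTheory.LFunctions.ConnesProlateGuess
import HarnessLib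

/-!
# Connes 2026 (Letter) §7 — the semilocal adele class space and the semilocal trace formula (STATEMENT LAYER)

LABEL (line 1): RH-FREE literature typing.  Nothing in this file bears on the truth of RH: a trace formula
for cutoffs and the bookkeeping of `S`-units are what they are; the one named fact below
(`Connes1999_thm_VII_4_rat`) is a published THEOREM (Connes 1999) typed without proof, not a conjecture.
WHAT THIS IS NOT: any statement of positivity with a prime (none is in print — see
`ConnesConsani2021/SemilocalSoninSpace.lean`, "What is NOT in this file"), any claim about RH, any route.

Source typed: A. Connes, *The Riemann Hypothesis: past, present and a letter through time*, arXiv:2602.04022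
(2026) [bib `Connes2026Letter`], §7 "Geometric perspectives", §§7.1–7.6 (held text `paper:arxiv-2602.04022`,
chunk locators `pNNNN:Lnn`), with the ORIGINAL sources of what §7 surveys: A. Connes, *Trace formula in
noncommutative geometry and the zeros of the Riemann zeta function*, Selecta Math. 5 (1999) [`Connes1999`],
§VII (1)–(13) and Theorem VII.4 (held `paper:arxiv-math_9811068`, p0012–p0013); A. Connes, C. Consani, *Knots,
primes and class field theory*, arXiv:2501.06560 [`ConnesConsani2025KnotsCFT`], §5.1–§5.2, Theorem 5.3 (held,
p0015–p0016); Connes–Consani–Moscovici 2024 [`ConnesConsaniMoscovici2024`] §4 for the pulled-back semilocal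
Fourier transform (tree file `SemilocalSoninSpace.lean`).  Cell `rh-crit`, sub-cell `cc/`, overflow row O1.

## Item-by-item map of Letter §7 (what is typed, cited, or deliberately not typed)

* **§7 intro** (p0024:L1–L13), Schwartz kernel `k(x,y) = δ(λx − y)` of the scaling action — prose; nothing typed.
* **§7.1 display** (p0024:L24), the archimedean trace formula "`W_∞(f) = log(TW) f(1) +
  Trace(ϑ(f)(1 − P_T − P̂_W))`", attributed to [Co-zeta].  The objects ARE typed: `P_T = cutoffProj T`,
  `P̂_W = dualCutoffProj ∅ W` (`semilocalFourierOf_empty`: `𝔽_∅ = 𝔽_{e_ℝ}`), `ϑ(f)` = the tree's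
  `ConnesConsani2021.scalingOp` (seat ex-gm-t15, `ScalingOperator.lean`).  The two-cutoff EXACT identity is NOT typed as a named fact: [Co-zeta] = Connes 1999
  proves the ASYMPTOTIC form (Thm V.3 for `K = ℝ`; Thm VII.4, typed below; its `P = ∅` instance is made
  explicit as `Connes1999_thm_VII_4_rat.archimedean`, `cutoffR_empty`), and no printed proof
  of the exact identity was located (asked of rh-crit-lit on the cell bus); `W_∞` itself is the tree's
  `ConnesConsani2021.archW = weilArchTermBombieri` (`= −connesArchPV`, `connesArchPV_eq_neg_weilArchTerm`).
* **§7.2 Theorem 7.1** (p0024:L37) = Connes–Consani 2021 Thm 1 = tree fact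
  `ConnesConsani2021.WeilArchPositivity_soninTrace`: ALIAS `letter_thm_7_1_iff` (`Iff.rfl`, no second fact).
* **§7.3 displays** (p0024:L48–L57): `Y_S := 𝔸_S/Γ_S`, `𝔸_S = ∏_{v∈S} ℚ_v`, `Γ_S = {± p_1^{n_1}⋯p_k^{n_k}}`
  — TYPED: `sIntegers` (`ℤ_S`), `sUnits` (`Γ_S = ℤ_S^×`, `mem_sUnits_iff_mem_sIntegers`; explicit form
  `val_eq_sign_mul_prod_of_mem_sUnits`, PROVED by unique factorisation), `SemilocalAdele`, `diag`,
  `adeleClassSpace` (`Y_S`); dictionary with `KnotsPrimesSemilocal.lean` (`gamma_le_sUnits`).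
* **§7.3 Theorem 7.2** (p0025:L5–L11) = Connes–Consani 2025 Thm 5.3 (sheaf `𝒮 ⋊ 𝐆_m` of crossed products on
  `Spec ℤ`; sections over `S^c` = `𝒮(𝔸_S) ⋊ ℤ_S^×`; generic stalk `𝒮(𝔸_ℚ) ⋊ ℚ^×`; global sections
  `𝒮(ℝ) ⋊ {±1}`).  TYPED AND PROVED: its `𝐆_m`-skeleton, which is the whole GROUP content of the three
  bullets and the gluing step of the printed proof ("`q_j ∈ ∩_k 𝐆_m(S_k^c)` hence `q_j ∈ 𝐆_m(S^c)`"):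
  `sUnits_mono` (presheaf), `sUnits_iInter`/`sUnits_inter` (gluing), `sUnits_univ`,
  `iSup_sUnits_finset`, `mem_sUnits_primeFactors` (generic stalk `ℚ^×`), `mem_sUnits_empty_iff` (global
  sections `{±1}`).  NOT TYPED: the Bruhat–Schwartz algebras `𝒮(𝔸_S)` (CC 2025 Prop 5.2, Lemma 5.1) and the
  algebraic crossed products — Mathlib has no Schwartz–Bruhat space of `ℚ_p`; recorded as a gap, not a fact.
* **§7.4 display** (p0025:L16) the semilocal trace formula, and the displays p0025:L18–L37: `Mod_S`,
  `GL₁(𝔸_S)`, `C_S`, `w_S : L²(Y_S) → L²(C_S)` ([CMbook] Prop 2.30), `Mod_S(λ) = |λ|_S`, `K_S = ker Mod_S`,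
  "`C_S ≅ ℝ_+^* × K_S` (non-canonically)", "the trace formula in [this] form is the specialization of [Co-zeta] to the `K_S`-invariant
  part".  TYPED: `modAdele`, `SemilocalIdele`, `diagUnits`, `ideleClassGroup` (`C_S`), `modIdele`,
  `idelesModOne` (`J_S^1`), `kerMod` (`K_S`), `modClassSpace`/`modClass` (the descent of `Mod_S` to `Y_S`
  and `C_S`), with the PRODUCT FORMULA on `Γ_S` PROVED (`modAdele_diag_eq_one`: `|γ|_∞ ∏_p |γ|_p = 1`);
  the trace formula itself as the named fact `Connes1999_thm_VII_4_rat` over the tree's geometric side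
  `ConnesConsani.connesSemilocalGeometricSide` (the as-printed asymptotic form of Connes 1999 Thm VII.4,
  `k = ℚ`, in the `K_S`-invariant picture; see "Design" before the declaration); the splitting
  `C_S ≅ ℝ_+^* × K_S` PROVED via the archimedean section `archSection` (`existsUnique_archSection_mul_kerMod`,
  `archSection_mul_injective`, `exists_modClass_eq`).  NOT TYPED: `w_S` and `L²(Y_S)` (Haar measure on
  `𝔸_S`, no Schwartz–Bruhat space), compactness of `K_S`, cocompactness of `Γ_S` in `J_S^1`.
* **§7.5** (p0025:L39–p0026:L10) IR/UV regimes — prose (no statement); **Theorem 7.3** (p0026:L10) = A. Connes,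
  *Heat expansion and zeta*, Ann. Funct. Anal. 15 (2024) Thm 1.1 [`Connes2024HeatExpansion`] (heat-trace
  asymptotics of the zeta zeros ASSUMING RH, Bernoulli/Euler coefficients) — typed in its own file
  `Literature/NumberTheory/LFunctions/ZetaHeatExpansion.lean` (same seat), not here.
* **§7.6 display** (p0026:L33) the prolate wave operator `PW_λ` — TYPED as the differential expression
  `prolateWaveExpr` with the dictionary to the tree's `IsProlateFunction` (`prolateWaveExpr_eigen_iff`,
  `IsProlateFunction.prolateWaveExpr_eq`).  NOT TYPED (source Connes–Moscovici, PNAS 119 (2022)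
  [`ConnesMoscovici2022UVProlate`] not held; Letter p0026:L35–p0027 is a summary): the self-adjoint
  extension of `PW_λ` to `L²(ℝ)` commuting with `P_λ, P̂_λ`, its restriction to Sonin's space, the negative
  spectrum `ν_k` and the Dirac square root `D` with the UV asymptotics of the zeros (CM Thm 5.1, quoted in
  Connes 2024 eq. (1.3): `N(E) = (E/2π)(log(E/2π) − 1) + O(log E)`).

## Design of the trace-formula typing (the `K_S`-invariant picture)

See the section docstring "§7.1 / §7.4" below: `L²(X_S)^{K_S} ≅ L²(ℝ)_ev` unitarily; `P_Λ ↦ cutoffProj Λ`,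
`F ↦ semilocalFourierOf P = θ_S 𝔽_{e_ℝ} θ_S⁻¹` (`θ_S = ∏ θ_p`, `twistProd`), `U(h) ↦ ϑ(g ∘ log) = scalingOp g`,
"Trace" ↦ the diagonal series `Σ_i ⟪e_i, ϑ(f) R_Λ e_i⟫` along an arbitrary Hilbert basis of `evenPart`.
No instance, notation or attribute is declared; every definition has a body; the only `def … : Prop`
without proof is `Connes1999_thm_VII_4_rat`.
-/

noncomputable section

open _root_.MeasureTheory Complex Set Filter Finset
open scoped Real Topology ComplexConjugate ENNReal InnerProductSpace

namespace Literature.NumberTheory.Connes2026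

open Literature.NumberTheory.LFunctions Literature.NumberTheory.ConnesConsani
  Literature.NumberTheory.ConnesConsani2021 Literature.Analysis.OperatorTheory

/-! ## §7.3 (i): the `S`-integers `ℤ_S`, the `S`-units `Γ_S = ℤ_S^× = 𝐆_m(S^c)` -/

/-- The ring `ℤ_S ⊆ ℚ` of rationals "whose denominators involve only primes `p ∈ S`":
`ℤ_S = {q ∈ ℚ | |q|_v ≤ 1 ∀ v ∉ S}` (Connes–Consani 2025, §5.1), i.e. `v_ℓ(q) ≥ 0` for every prime
`ℓ ∉ S`.  Here `S` is any set of natural numbers (only its primes matter; `S` = the finite places of the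
Letter's `S ∋ ∞`); `S = ∅` gives `ℤ`, `S ⊇ primes` gives `ℚ`. [cite: ConnesConsani2025KnotsCFT, §5.1 (arXiv p0015:L17)] -/
def sIntegers (S : Set ℕ) : Subring ℚ where
  carrier := {q | ∀ ℓ : ℕ, ℓ.Prime → ℓ ∉ S → 0 ≤ padicValRat ℓ q}
  zero_mem' := fun ℓ _ _ => by simp
  one_mem' := fun ℓ _ _ => by simp
  add_mem' := by
    intro q r hq hr ℓ hℓ hℓS
    haveI : Fact ℓ.Prime := ⟨hℓ⟩
    by_cases hqr : q + r = 0
    · simp [hqr]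
    · exact (le_min (hq ℓ hℓ hℓS) (hr ℓ hℓ hℓS)).trans (padicValRat.min_le_padicValRat_add hqr)
  neg_mem' := by
    intro q hq ℓ hℓ hℓS
    rw [padicValRat.neg]
    exact hq ℓ hℓ hℓS
  mul_mem' := by
    intro q r hq hr ℓ hℓ hℓS
    haveI : Fact ℓ.Prime := ⟨hℓ⟩
    by_cases hq0 : q = 0
    · simp [hq0]
    by_cases hr0 : r = 0
    · simp [hr0]
    rw [padicValRat.mul hq0 hr0]
    exact add_nonneg (hq ℓ hℓ hℓS) (hr ℓ hℓ hℓS)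

/-- Membership in `ℤ_S`. [cite: ConnesConsani2025KnotsCFT, §5.1 (arXiv p0015:L17)] -/
theorem mem_sIntegers_iff {S : Set ℕ} {q : ℚ} :
    q ∈ sIntegers S ↔ ∀ ℓ : ℕ, ℓ.Prime → ℓ ∉ S → 0 ≤ padicValRat ℓ q :=
  Iff.rfl

/-- **The group `Γ_S` of `S`-units** (Letter §7.3, display: `Γ_S := {± p_1^{n_1} ⋯ p_k^{n_k} : p_j ∈ S ∖ {∞},
n_j ∈ ℤ} ⊂ ℚ^×`; Connes 1999 VII (1): `O_S^* = {q ∈ k^*, |q_v| = 1, v ∉ S}`; Connes–Consani 2025 §5.1: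
`Γ_S = ℤ_S^×`, "conceptually, `Γ_S` is the group `𝐆_m(S^c)` of sections of the sheaf `𝐆_m` on the open
set `S^c ⊂ Spec ℤ`"), as the subgroup of `ℚˣ` of units with `v_ℓ = 0` at every prime `ℓ ∉ S`.  The
explicit form `± ∏ p^{n_p}` is `val_eq_sign_mul_prod_of_mem_sUnits`. [cite: Connes2026Letter, §7.3, display defining Γ_S (arXiv p0024:L55); Connes1999, §VII eq. (1)] -/
def sUnits (S : Set ℕ) : Subgroup ℚˣ where
  carrier := {u | ∀ ℓ : ℕ, ℓ.Prime → ℓ ∉ S → padicValRat ℓ (u : ℚ) = 0}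
  one_mem' := fun ℓ _ _ => by simp
  mul_mem' := by
    intro u v hu hv ℓ hℓ hℓS
    haveI : Fact ℓ.Prime := ⟨hℓ⟩
    rw [Units.val_mul, padicValRat.mul u.ne_zero v.ne_zero, hu ℓ hℓ hℓS, hv ℓ hℓ hℓS, add_zero]
  inv_mem' := by
    intro u hu ℓ hℓ hℓS
    haveI : Fact ℓ.Prime := ⟨hℓ⟩
    rw [Units.val_inv_eq_inv_val, padicValRat.inv, hu ℓ hℓ hℓS, neg_zero]

/-- Membership in `Γ_S`: all valuations outside `S` vanish. [cite: Connes1999, §VII eq. (1)] -/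
theorem mem_sUnits_iff {S : Set ℕ} {u : ℚˣ} :
    u ∈ sUnits S ↔ ∀ ℓ : ℕ, ℓ.Prime → ℓ ∉ S → padicValRat ℓ (u : ℚ) = 0 :=
  Iff.rfl

/-- `Γ_S = ℤ_S^×`: a unit of `ℚ` lies in `Γ_S` iff it and its inverse lie in `ℤ_S`
(Connes–Consani 2025 §5.1: "the group `Γ_S` of the invertible elements of `ℤ_S`"). [cite: ConnesConsani2025KnotsCFT, §5.1 (arXiv p0015:L19)] -/
theorem mem_sUnits_iff_mem_sIntegers {S : Set ℕ} {u : ℚˣ} :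
    u ∈ sUnits S ↔ (u : ℚ) ∈ sIntegers S ∧ ((u⁻¹ : ℚˣ) : ℚ) ∈ sIntegers S := by
  simp only [mem_sUnits_iff, mem_sIntegers_iff, Units.val_inv_eq_inv_val]
  constructor
  · intro h
    refine ⟨fun ℓ hℓ hℓS => (h ℓ hℓ hℓS).ge, fun ℓ hℓ hℓS => ?_⟩
    haveI : Fact ℓ.Prime := ⟨hℓ⟩
    rw [padicValRat.inv, h ℓ hℓ hℓS, neg_zero]
  · rintro ⟨h1, h2⟩ ℓ hℓ hℓS
    haveI : Fact ℓ.Prime := ⟨hℓ⟩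
    have e1 := h1 ℓ hℓ hℓS
    have e2 := h2 ℓ hℓ hℓS
    rw [padicValRat.inv] at e2
    omega

/-- `-1 ∈ Γ_S` (the sign). [cite: Connes2026Letter, §7.3, display defining Γ_S (arXiv p0024:L55)] -/
theorem neg_one_mem_sUnits (S : Set ℕ) : (-1 : ℚˣ) ∈ sUnits S := fun ℓ _ _ => by
  rw [Units.val_neg, Units.val_one, padicValRat.neg, padicValRat.one]

/-- A prime `p ∈ S` is an `S`-unit. [cite: Connes2026Letter, §7.3, display defining Γ_S (arXiv p0024:L55)] -/
theorem prime_mem_sUnits {S : Set ℕ} {p : ℕ} (hp : p.Prime) (hpS : p ∈ S) :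
    Units.mk0 (p : ℚ) (by exact_mod_cast hp.ne_zero) ∈ sUnits S := by
  intro ℓ hℓ hℓS
  haveI : Fact ℓ.Prime := ⟨hℓ⟩
  haveI : Fact p.Prime := ⟨hp⟩
  have hℓp : ℓ ≠ p := fun h => hℓS (h ▸ hpS)
  rw [Units.val_mk0, padicValRat.of_nat]
  exact_mod_cast padicValNat_primes hℓp

/-- PRESHEAF: `S ⊆ S'` ⇒ `Γ_S ≤ Γ_{S'}` (restriction maps of `𝐆_m` along `S'^c ⊆ S^c` are inclusions inside
the constant sheaf `ℚ^×`; Connes–Consani 2025, proof of Thm 5.3). [cite: ConnesConsani2025KnotsCFT, Thm 5.3 proof (arXiv p0016:L34)] -/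
theorem sUnits_mono {S S' : Set ℕ} (h : S ⊆ S') : sUnits S ≤ sUnits S' :=
  fun _ hu ℓ hℓ hℓS' => hu ℓ hℓ fun hℓS => hℓS' (h hℓS)

/-- SHEAF GLUING for `𝐆_m` (the step "`q_j ∈ ∩_k 𝐆_m(S_k^c)` and hence `q_j ∈ 𝐆_m(S^c)`", `S = ∩ S_k`,
of the proof of Connes–Consani 2025 Thm 5.3): `Γ_{⋂ S_k} = ⨅ Γ_{S_k}` for any family. PROVED.
[cite: ConnesConsani2025KnotsCFT, Thm 5.3 proof (arXiv p0016:L39)] -/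
theorem sUnits_iInter {κ : Sort*} (S : κ → Set ℕ) : sUnits (⋂ k, S k) = ⨅ k, sUnits (S k) := by
  apply le_antisymm
  · exact le_iInf fun k => sUnits_mono (Set.iInter_subset S k)
  · intro u hu ℓ hℓ hℓS
    rw [Set.mem_iInter, not_forall] at hℓS
    obtain ⟨k, hk⟩ := hℓS
    exact (Subgroup.mem_iInf.mp hu k) ℓ hℓ hk

/-- Binary gluing: `Γ_{S ∩ S'} = Γ_S ⊓ Γ_{S'}`. [cite: ConnesConsani2025KnotsCFT, Thm 5.3 proof (arXiv p0016:L39)] -/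
theorem sUnits_inter (S S' : Set ℕ) : sUnits (S ∩ S') = sUnits S ⊓ sUnits S' := by
  apply le_antisymm
  · exact le_inf (sUnits_mono Set.inter_subset_left) (sUnits_mono Set.inter_subset_right)
  · rintro u ⟨h1, h2⟩ ℓ hℓ hℓS
    by_cases hℓ1 : ℓ ∈ S
    · exact h2 ℓ hℓ fun h => hℓS ⟨hℓ1, h⟩
    · exact h1 ℓ hℓ hℓ1

/-- STALK AT THE GENERIC POINT: with every prime allowed, `Γ = ℚ^×` (Letter Thm 7.2, second bullet /
Connes–Consani 2025 Thm 5.3 (2): the stalk at the generic point is the GLOBAL cross product by `ℚ^×`).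
[cite: Connes2026Letter, Thm 7.2 (arXiv p0025:L10); ConnesConsani2025KnotsCFT, Thm 5.3 (2)] -/
theorem sUnits_univ : sUnits (Set.univ : Set ℕ) = ⊤ :=
  top_unique fun _ _ _ _ h => (h (Set.mem_univ _)).elim

/-- Every `u ∈ ℚ^×` is an `S`-unit for the FINITE set `S` of primes dividing its numerator or
denominator; hence `ℚ^× = ⋃_{S finite} Γ_S` (the generic stalk as a union of sections).
[cite: ConnesConsani2025KnotsCFT, Thm 5.3 (2) (arXiv p0016:L31)] -/
theorem mem_sUnits_primeFactors (u : ℚˣ) :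
    u ∈ sUnits (↑((u : ℚ).num.natAbs.primeFactors ∪ (u : ℚ).den.primeFactors) : Set ℕ) := by
  intro ℓ hℓ hℓS
  haveI : Fact ℓ.Prime := ⟨hℓ⟩
  simp only [coe_union, Set.mem_union, mem_coe, Nat.mem_primeFactors, not_or, not_and] at hℓS
  have hnum : (u : ℚ).num ≠ 0 := Rat.num_ne_zero.mpr u.ne_zero
  have h1 : ¬ ℓ ∣ (u : ℚ).num.natAbs := fun h => hℓS.1 hℓ h (Int.natAbs_ne_zero.mpr hnum)
  have h2 : ¬ ℓ ∣ (u : ℚ).den := fun h => hℓS.2 hℓ h (u : ℚ).den_ne_zero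
  rw [padicValRat_def, padicValInt, padicValNat.eq_zero_of_not_dvd h1,
    padicValNat.eq_zero_of_not_dvd h2]
  simp

/-- The generic stalk is exhausted by the sections over cofinite opens: `⨆_{S finite} Γ_S = ℚ^×`.
[cite: ConnesConsani2025KnotsCFT, Thm 5.3 (2) (arXiv p0016:L31)] -/
theorem iSup_sUnits_finset : ⨆ S : Finset ℕ, sUnits (↑S : Set ℕ) = ⊤ :=
  top_unique fun u _ => Subgroup.mem_iSup_of_mem _ (mem_sUnits_primeFactors u)

/-- GLOBAL SECTIONS: `Γ_∅ = {±1}` — with no finite place allowed the only units are `±1` (Letter Thm 7.2,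
third bullet / Connes–Consani 2025 Thm 5.3 (3): global sections `𝒮(ℝ) ⋊ {±1}`). PROVED.
[cite: Connes2026Letter, Thm 7.2 (arXiv p0025:L11); ConnesConsani2025KnotsCFT, Thm 5.3 (3)] -/
theorem mem_sUnits_empty_iff (u : ℚˣ) : u ∈ sUnits (∅ : Set ℕ) ↔ u = 1 ∨ u = -1 := by
  constructor
  · intro hu
    have hnum : (u : ℚ).num ≠ 0 := Rat.num_ne_zero.mpr u.ne_zero
    -- every prime divides neither the numerator nor the denominator
    have key : ∀ ℓ : ℕ, ℓ.Prime → ¬ ℓ ∣ (u : ℚ).num.natAbs ∧ ¬ ℓ ∣ (u : ℚ).den := by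
      intro ℓ hℓ
      haveI : Fact ℓ.Prime := ⟨hℓ⟩
      have h0 := hu ℓ hℓ (Set.notMem_empty ℓ)
      rw [padicValRat_def, padicValInt] at h0
      have hcop : Nat.Coprime (u : ℚ).num.natAbs (u : ℚ).den := (u : ℚ).reduced
      by_contra hcon
      rw [not_and_or, not_not, not_not] at hcon
      rcases hcon with h | h
      · have hnd : ¬ ℓ ∣ (u : ℚ).den := fun h' =>
          hℓ.one_lt.ne' (Nat.dvd_one.mp (hcop.gcd_eq_one ▸ Nat.dvd_gcd h h'))
        rw [padicValNat.eq_zero_of_not_dvd hnd] at h0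
        have hpos : 0 < padicValNat ℓ (u : ℚ).num.natAbs :=
          Nat.pos_of_ne_zero ((padicValNat.eq_zero_iff.not).mpr (by
            push Not; exact ⟨hℓ.one_lt.ne', Int.natAbs_ne_zero.mpr hnum, h⟩))
        omega
      · have hnn : ¬ ℓ ∣ (u : ℚ).num.natAbs := fun h' =>
          hℓ.one_lt.ne' (Nat.dvd_one.mp (hcop.gcd_eq_one ▸ Nat.dvd_gcd h' h))
        rw [padicValNat.eq_zero_of_not_dvd hnn] at h0
        have hpos : 0 < padicValNat ℓ (u : ℚ).den :=
          Nat.pos_of_ne_zero ((padicValNat.eq_zero_iff.not).mpr (by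
            push Not; exact ⟨hℓ.one_lt.ne', (u : ℚ).den_ne_zero, h⟩))
        omega
    have hn1 : (u : ℚ).num.natAbs = 1 :=
      Nat.eq_one_iff_not_exists_prime_dvd.mpr fun ℓ hℓ => (key ℓ hℓ).1
    have hd1 : (u : ℚ).den = 1 :=
      Nat.eq_one_iff_not_exists_prime_dvd.mpr fun ℓ hℓ => (key ℓ hℓ).2
    have hq : (u : ℚ) = (u : ℚ).num := by
      conv_lhs => rw [← Rat.num_div_den (u : ℚ), hd1]
      simp
    rcases Int.natAbs_eq_iff.mp hn1 with h | h
    · left; ext; rw [hq, h]; simp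
    · right; ext; rw [hq, h]; simp
  · rintro (rfl | rfl)
    · exact Subgroup.one_mem _
    · exact neg_one_mem_sUnits ∅

/-- Dictionary with the `S = {p, q, ∞}` layer of `KnotsPrimesSemilocal.lean`: Connes–Consani 2024's
`Γ = {± p^m q^n}` lies in `Γ_{{p,q}}` (each `± p^m q^n` has valuation `0` at every other prime).
[cite: ConnesConsani2024KnotsPrimes, §3 eq. (Γ) p. 6] -/
theorem gamma_le_sUnits (p q : ℕ) [hp : Fact p.Prime] [hq : Fact q.Prime] :
    ConnesConsani2024.Gamma p q ≤ sUnits ({p, q} : Set ℕ) := by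
  rintro u ⟨ε, m, n, hε, hu⟩ ℓ hℓ hℓS
  haveI : Fact ℓ.Prime := ⟨hℓ⟩
  simp only [Set.mem_insert_iff, Set.mem_singleton_iff, not_or] at hℓS
  have hp0 : (p : ℚ) ≠ 0 := by exact_mod_cast hp.out.ne_zero
  have hq0 : (q : ℚ) ≠ 0 := by exact_mod_cast hq.out.ne_zero
  have hε0 : ε ≠ 0 := by rcases hε with rfl | rfl <;> norm_num
  have hvε : padicValRat ℓ ε = 0 := by
    rcases hε with rfl | rfl
    · exact padicValRat.one
    · rw [padicValRat.neg]; exact padicValRat.one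
  have hvp : padicValRat ℓ (p : ℚ) = 0 := by
    rw [padicValRat.of_nat]; exact_mod_cast padicValNat_primes hℓS.1
  have hvq : padicValRat ℓ (q : ℚ) = 0 := by
    rw [padicValRat.of_nat]; exact_mod_cast padicValNat_primes hℓS.2
  rw [hu, padicValRat.mul (mul_ne_zero hε0 (zpow_ne_zero m hp0)) (zpow_ne_zero n hq0),
    padicValRat.mul hε0 (zpow_ne_zero m hp0), padicValRat.zpow, padicValRat.zpow, hvε, hvp, hvq]
  simp

/-! ## §7.3 (ii): the product formula on `Γ_S` — `|u|_∞ = ∏_{p ∈ S} p^{v_p(u)}` -/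

/-- For a natural number `n ≠ 0` and a finite set `T` of primes containing its prime factors,
`n = ∏_{p ∈ T} p^{v_p(n)}` (unique factorisation, `Nat.prod_factorization_pow_eq_self`). [folklore] -/
private theorem natCast_eq_prod_pow_padicValNat {n : ℕ} (hn : n ≠ 0) {T : Finset ℕ}
    (hT : n.primeFactors ⊆ T) (hTp : ∀ p ∈ T, p.Prime) :
    (n : ℚ) = ∏ p ∈ T, (p : ℚ) ^ padicValNat p n := by
  have h := Nat.prod_factorization_pow_eq_self hn
  rw [Finsupp.prod, Nat.support_factorization] at h
  rw [Finset.prod_subset hT (fun p _ hp => by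
    rw [Finsupp.notMem_support_iff.mp (by rwa [Nat.support_factorization]), pow_zero])] at h
  have h' : (n : ℚ) = ∏ p ∈ T, (((p ^ n.factorization p : ℕ)) : ℚ) := by
    rw [← Nat.cast_prod, h]
  rw [h']
  exact Finset.prod_congr rfl fun p hp => by rw [Nat.cast_pow, Nat.factorization_def n (hTp p hp)]

/-- **`|u| = ∏_{p ∈ T} p^{v_p(u)}`** for a non-zero rational `u` and any finite set `T` of primes containing
the primes of its numerator and denominator — the archimedean absolute value is recovered from the finite
valuations (product formula; the content of "`Γ_S = {± p_1^{n_1} ⋯ p_k^{n_k}}`", Connes–Consani 2025 §5.1).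
[cite: ConnesConsani2025KnotsCFT, §5.1 (arXiv p0015:L19–L22)] -/
theorem abs_eq_prod_zpow_padicValRat {u : ℚ} (hu : u ≠ 0) {T : Finset ℕ}
    (hT : u.num.natAbs.primeFactors ∪ u.den.primeFactors ⊆ T) (hTp : ∀ p ∈ T, p.Prime) :
    |u| = ∏ p ∈ T, (p : ℚ) ^ padicValRat p u := by
  have hnum : u.num ≠ 0 := Rat.num_ne_zero.mpr hu
  have hN : u.num.natAbs ≠ 0 := Int.natAbs_ne_zero.mpr hnum
  have h1 := natCast_eq_prod_pow_padicValNat hN (Finset.subset_union_left.trans hT) hTp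
  have h2 := natCast_eq_prod_pow_padicValNat u.den_ne_zero (Finset.subset_union_right.trans hT) hTp
  have habs : |u| = (u.num.natAbs : ℚ) / (u.den : ℚ) := by
    conv_lhs => rw [← Rat.num_div_den u]
    rw [abs_div, Nat.abs_cast, Nat.cast_natAbs, Int.cast_abs]
  rw [habs, h1, h2, ← Finset.prod_div_distrib]
  refine Finset.prod_congr rfl fun p hp => ?_
  have hp0 : (p : ℚ) ≠ 0 := by exact_mod_cast (hTp p hp).ne_zero
  rw [padicValRat_def, padicValInt, zpow_sub₀ hp0, zpow_natCast, zpow_natCast]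

/-- The explicit form of an `S`-unit (Letter §7.3 display, Connes–Consani 2025 §5.1): for a finite set `S` of
primes and `u ∈ Γ_S`, `u = ± ∏_{p ∈ S} p^{n_p}` with `n_p = v_p(u)` and the sign of `u`. PROVED from
unique factorisation. [cite: Connes2026Letter, §7.3, display defining Γ_S (arXiv p0024:L55); ConnesConsani2025KnotsCFT, §5.1] -/
theorem val_eq_sign_mul_prod_of_mem_sUnits {S : Finset ℕ} (hS : ∀ p ∈ S, p.Prime) {u : ℚˣ}
    (hu : u ∈ sUnits (↑S : Set ℕ)) :
    (u : ℚ) = (if 0 < (u : ℚ) then 1 else -1) * ∏ p ∈ S, (p : ℚ) ^ padicValRat p (u : ℚ) := by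
  classical
  -- enlarge `S` by the prime factors of `u`; the new primes have exponent `0`
  set T := S ∪ ((u : ℚ).num.natAbs.primeFactors ∪ (u : ℚ).den.primeFactors) with hTdef
  have hTp : ∀ p ∈ T, p.Prime := by
    intro p hp
    rcases Finset.mem_union.mp hp with h | h
    · exact hS p h
    · rcases Finset.mem_union.mp h with h | h <;> exact Nat.prime_of_mem_primeFactors h
  have habs := abs_eq_prod_zpow_padicValRat u.ne_zero (T := T) Finset.subset_union_right hTp
  have hprod : ∏ p ∈ T, (p : ℚ) ^ padicValRat p (u : ℚ) = ∏ p ∈ S, (p : ℚ) ^ padicValRat p (u : ℚ) := by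
    rw [← Finset.prod_subset (Finset.subset_union_left : S ⊆ T)]
    intro p hpT hpS
    rw [hu p (hTp p hpT) (by exact_mod_cast hpS), zpow_zero]
  rw [← hprod, ← habs]
  split_ifs with h
  · rw [one_mul, abs_of_pos h]
  · rw [abs_of_neg (lt_of_le_of_ne (not_lt.mp h) u.ne_zero), neg_one_mul, neg_neg]


/-! ## §7.3 (iii): semilocal adeles `𝔸_S`, `Y_S = 𝔸_S/Γ_S`, ideles, `C_S`, the module `Mod_S`, `K_S`

`S = {∞} ∪ {p_i : i ∈ ι}` is presented by a FAMILY of primes `p : ι → ℕ` (so that `ℚ_[p i]` finds its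
`Fact (p i).Prime` instance from the hypothesis `[∀ i, Fact (p i).Prime]`; no instance is declared here).
The finite places as a set: `Set.range p`; `Γ_S = sUnits (Set.range p)`.  For `ι = Fin 2` this is the
`S = {p, q, ∞}` space `ConnesConsani2024.SemilocalClassSpace p q` of `KnotsPrimesSemilocal.lean` up to the
order of the factors (there `ℚ_p × ℚ_q × ℝ`, group `Gamma p q ≤ Γ_{{p,q}}`: `gamma_le_sUnits`).
-/

section Adelic

variable {ι : Type} (p : ι → ℕ) [hp : ∀ i, Fact (p i).Prime]

/-- The semilocal adeles `𝔸_S = ∏_{v ∈ S} ℚ_v = ℝ × ∏_i ℚ_{p_i}` (Letter §7.3 display; Connes 1999 §VII: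
`A_S = ∏_{v∈S} k_v`), a commutative topological ring containing `ℚ` diagonally.
[cite: Connes2026Letter, §7.3, display defining Y_S and 𝔸_S (arXiv p0024:L50); Connes1999, §VII] -/
abbrev SemilocalAdele : Type := ℝ × ((i : ι) → ℚ_[p i])

/-- The diagonal embedding `ℚ ⊂ 𝔸_S` ("The ring `𝔸_S` contains `ℚ` as a subring using the diagonal
embedding", Letter §7.3). [cite: Connes2026Letter, §7.3 (arXiv p0025:L1)] -/
def diag : ℚ →+* SemilocalAdele p :=
  RingHom.prod (Rat.castHom ℝ) (RingHom.pi fun i => Rat.castHom ℚ_[p i])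

/-- The diagonal embedding is `q ↦ (q, (q)_i)`. [cite: Connes2026Letter, §7.3 (arXiv p0025:L1)] -/
theorem diag_apply (q : ℚ) : diag p q = ((q : ℝ), fun i => (q : ℚ_[p i])) := rfl

/-- The action of `Γ_S ⊂ ℚ^×` on `𝔸_S` "by multiplication" through the diagonal embedding is the
`ℚ`-module action: `u • (x_∞, (x_i)) = (u x_∞, (u x_i))`. [cite: Connes2026Letter, §7.3 (arXiv p0025:L1)] -/
theorem units_smul_eq_diag_mul (u : ℚˣ) (x : SemilocalAdele p) : u • x = diag p u * x := by
  rcases x with ⟨a, b⟩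
  rw [Units.smul_def, diag_apply]
  ext i
  · simp [Rat.smul_def]
  · simp [Rat.smul_def]

/-- **The semilocal adele class space `Y_S := 𝔸_S/Γ_S`** (Letter §7.3 display; Connes 1999 §VII:
`X_S = A_S/O_S^*`; Connes–Consani 2025 §5.1: `Y_{ℚ,S} := Γ_S\𝔸_S`): the space of `Γ_S`-orbits.
[cite: Connes2026Letter, §7.3, display defining Y_S and 𝔸_S (arXiv p0024:L50); Connes1999, §VII; ConnesConsani2025KnotsCFT, §5.1] -/
abbrev adeleClassSpace : Type :=
  MulAction.orbitRel.Quotient (sUnits (Set.range p)) (SemilocalAdele p)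

/-- The idele group `GL₁(𝔸_S) = ∏_{v∈S} GL₁(ℚ_v)` (Letter §7.4 display; Connes 1999 VII (2): `J_S`).
[cite: Connes2026Letter, §7.4, display defining GL₁(𝔸_S), C_S (arXiv p0025:L24); Connes1999, §VII eq. (2)] -/
abbrev SemilocalIdele : Type := ℝˣ × ((i : ι) → (ℚ_[p i])ˣ)

/-- The diagonal embedding of `ℚ^× ⊇ Γ_S` into the ideles. [cite: Connes1999, §VII eq. (2)] -/
def diagUnits : ℚˣ →* SemilocalIdele p :=
  MonoidHom.prod (Units.map (Rat.castHom ℝ : ℚ →+* ℝ).toMonoidHom)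
    (MonoidHom.pi fun i => Units.map (Rat.castHom ℚ_[p i] : ℚ →+* ℚ_[p i]).toMonoidHom)

/-- Components of the diagonal idele of `u ∈ ℚ^×`. [cite: Connes1999, §VII eq. (2)] -/
theorem diagUnits_apply (u : ℚˣ) :
    (((diagUnits p u).1 : ℝˣ) : ℝ) = (u : ℚ) ∧ ∀ i, (((diagUnits p u).2 i : (ℚ_[p i])ˣ) : ℚ_[p i]) = (u : ℚ) :=
  ⟨rfl, fun _ => rfl⟩

/-- **The semilocal idele class group `C_S := GL₁(𝔸_S)/Γ_S`** (Letter §7.4 display; Connes 1999 §VII: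
`C_S = J_S/O_S^*`). [cite: Connes2026Letter, §7.4, display defining GL₁(𝔸_S), C_S (arXiv p0025:L24); Connes1999, §VII] -/
abbrev ideleClassGroup : Type :=
  SemilocalIdele p ⧸ (sUnits (Set.range p)).map (diagUnits p)

variable [Fintype ι]

/-- The module `Mod_S(u) := |(u_v)|_S = ∏_{v∈S} |u_v|_v` on the semilocal adeles (Letter §7.4 display),
with `|·|_∞` the usual absolute value and `|·|_p` the normalised `p`-adic absolute value of Mathlib's `ℚ_[p]`.
[cite: Connes2026Letter, §7.4, display defining Mod_S on 𝔸_S (arXiv p0025:L20)] -/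
def modAdele (x : SemilocalAdele p) : ℝ := |x.1| * ∏ i, ‖x.2 i‖

/-- The module on ideles, `Mod_S(λ) = |λ|_S := ∏_{v∈S} |λ_v|` (Letter §7.4 display; Connes 1999 VII (3)).
[cite: Connes2026Letter, §7.4, display defining Mod_S on C_S (arXiv p0025:L33); Connes1999, §VII eq. (3)] -/
def modIdele (x : SemilocalIdele p) : ℝ := |(x.1 : ℝ)| * ∏ i, ‖((x.2 i : (ℚ_[p i])ˣ) : ℚ_[p i])‖

/-- `Mod_S` is multiplicative on `𝔸_S` ("extends to a multiplicative map `|∙|_S` from the ring `𝔸_S` to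
`ℝ_+`", Letter §7.4). [cite: Connes2026Letter, §7.4 (arXiv p0025:L18)] -/
theorem modAdele_mul (x y : SemilocalAdele p) : modAdele p (x * y) = modAdele p x * modAdele p y := by
  simp only [modAdele, Prod.fst_mul, Prod.snd_mul, Pi.mul_apply, abs_mul, norm_mul,
    Finset.prod_mul_distrib]
  ring

/-- `Mod_S(1) = 1` on ideles. [cite: Connes2026Letter, §7.4, display defining Mod_S on C_S (arXiv p0025:L33)] -/
theorem modIdele_one : modIdele p 1 = 1 := by simp [modIdele]

/-- `Mod_S` is a homomorphism on ideles (`C_S` "is a modulated locally compact group with module `Mod_S`").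
[cite: Connes2026Letter, §7.4, display defining Mod_S on C_S (arXiv p0025:L33)] -/
theorem modIdele_mul (x y : SemilocalIdele p) : modIdele p (x * y) = modIdele p x * modIdele p y := by
  simp only [modIdele, Prod.fst_mul, Prod.snd_mul, Pi.mul_apply, Units.val_mul, abs_mul, norm_mul,
    Finset.prod_mul_distrib]
  ring

/-- `Mod_S(λ) > 0` on ideles (values in `ℝ_+^*`). [cite: Connes2026Letter, §7.4, display defining Mod_S on C_S (arXiv p0025:L33)] -/
theorem modIdele_pos (x : SemilocalIdele p) : 0 < modIdele p x :=
  mul_pos (abs_pos.mpr x.1.ne_zero) (Finset.prod_pos fun i _ => norm_pos_iff.mpr (x.2 i).ne_zero)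

/-- `Mod_S(λ⁻¹) = Mod_S(λ)⁻¹`. [cite: Connes2026Letter, §7.4, display defining Mod_S on C_S (arXiv p0025:L33)] -/
theorem modIdele_inv (x : SemilocalIdele p) : modIdele p x⁻¹ = (modIdele p x)⁻¹ := by
  have h := modIdele_mul p x x⁻¹
  rw [mul_inv_cancel, modIdele_one] at h
  exact (eq_inv_of_mul_eq_one_right h.symm)

/-- The modules of the diagonal adele and idele of `u ∈ ℚ^×` agree: `|u|_∞ ∏_i ‖u‖_{p_i}`. [cite: Connes2026Letter, §7.4, displays defining Mod_S (arXiv p0025:L20, L33)] -/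
theorem modIdele_diagUnits (u : ℚˣ) : modIdele p (diagUnits p u) = modAdele p (diag p u) := rfl

/-- **Product formula on `Γ_S`: `Mod_S(γ) = 1` for `γ ∈ Γ_S`** (for distinct primes `p_i`): `|γ|_∞ = ∏_i
p_i^{v_i(γ)}` (`abs_eq_prod_zpow_padicValRat`) and `|γ|_{p_i} = p_i^{−v_i(γ)}`.  This is what makes
`Mod_S` pass to the quotients `Y_S = 𝔸_S/Γ_S` and `C_S` (Letter §7.4: "by construction this map passes to
the quotient as a map `Mod_S : Y_S → ℝ_+`"). PROVED. [cite: Connes2026Letter, §7.4 (arXiv p0025:L18)] -/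
theorem modAdele_diag_eq_one (hinj : Function.Injective p) {u : ℚˣ} (hu : u ∈ sUnits (Set.range p)) :
    modAdele p (diag p u) = 1 := by
  classical
  have hSp : ∀ q ∈ Finset.univ.image p, q.Prime := by
    intro q hq
    obtain ⟨i, -, rfl⟩ := Finset.mem_image.mp hq
    exact (hp i).out
  have hu' : u ∈ sUnits (↑(Finset.univ.image p) : Set ℕ) := by
    simpa [Finset.coe_image] using hu
  -- the archimedean absolute value from the valuations
  have habs : |((u : ℚ) : ℝ)| = ∏ i, ((p i : ℝ)) ^ padicValRat (p i) (u : ℚ) := by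
    have h := val_eq_sign_mul_prod_of_mem_sUnits hSp hu'
    rw [Finset.prod_image fun i _ j _ h => hinj h] at h
    have habsQ : |(u : ℚ)| = ∏ i, ((p i : ℚ)) ^ padicValRat (p i) (u : ℚ) := by
      have hpos : 0 < ∏ i, ((p i : ℚ)) ^ padicValRat (p i) (u : ℚ) :=
        Finset.prod_pos fun i _ => zpow_pos (by exact_mod_cast (hp i).out.pos) _
      conv_lhs => rw [h]
      split_ifs <;> simp [abs_of_pos hpos]
    have := congrArg (fun q : ℚ => (q : ℝ)) habsQ
    simpa [Rat.cast_abs, Rat.cast_prod, Rat.cast_zpow, Rat.cast_natCast] using this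
  -- the `p`-adic absolute values
  have hpad : ∀ i, ‖((u : ℚ) : ℚ_[p i])‖ = ((p i : ℝ)) ^ (-padicValRat (p i) (u : ℚ)) := by
    intro i
    rw [Padic.eq_padicNorm, padicNorm.eq_zpow_of_nonzero u.ne_zero]
    push_cast
    rfl
  simp only [modAdele, diag_apply]
  rw [habs, Finset.prod_congr rfl fun i _ => hpad i, ← Finset.prod_mul_distrib]
  refine Finset.prod_eq_one fun i _ => ?_
  have hp0 : (p i : ℝ) ≠ 0 := by exact_mod_cast (hp i).out.ne_zero
  rw [zpow_neg, mul_inv_cancel₀ (zpow_ne_zero _ hp0)]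

/-- `Mod_S(γ) = 1` on the diagonal ideles `γ ∈ Γ_S`. [cite: Connes2026Letter, §7.4 (arXiv p0025:L18)] -/
theorem modIdele_diagUnits_eq_one (hinj : Function.Injective p) {u : ℚˣ}
    (hu : u ∈ sUnits (Set.range p)) : modIdele p (diagUnits p u) = 1 := by
  rw [modIdele_diagUnits, modAdele_diag_eq_one p hinj hu]

/-- `Mod_S` is `Γ_S`-invariant on `𝔸_S`: `Mod_S(γ x) = Mod_S(x)`. [cite: Connes2026Letter, §7.4 (arXiv p0025:L18)] -/
theorem modAdele_smul (hinj : Function.Injective p) (γ : sUnits (Set.range p)) (x : SemilocalAdele p) :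
    modAdele p (γ • x) = modAdele p x := by
  rw [Subgroup.smul_def, units_smul_eq_diag_mul, modAdele_mul, modAdele_diag_eq_one p hinj γ.2, one_mul]

/-- **`Mod_S : Y_S = 𝔸_S/Γ_S → ℝ_+`**, the module on the semilocal adele class space (Letter §7.4: "passes to
the quotient"), well defined by the product formula `modAdele_smul`. [cite: Connes2026Letter, §7.4, display defining Mod_S on 𝔸_S (arXiv p0025:L18–L20)] -/
def modClassSpace (hinj : Function.Injective p) : adeleClassSpace p → ℝ :=
  Quotient.lift (modAdele p) fun x y hxy => by
    obtain ⟨γ, rfl⟩ := MulAction.orbitRel_apply.mp hxy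
    exact modAdele_smul p hinj γ y

/-- `Mod_S` of the class of `x` is `Mod_S(x)`. [cite: Connes2026Letter, §7.4, display defining Mod_S on 𝔸_S (arXiv p0025:L18–L20)] -/
theorem modClassSpace_mk (hinj : Function.Injective p) (x : SemilocalAdele p) :
    modClassSpace p hinj (Quotient.mk _ x) = modAdele p x := rfl

/-- The ideles of module `1`, `{λ ∈ GL₁(𝔸_S) : |λ|_S = 1}` (Connes 1999 VII (3): `J_S^1`), a subgroup.
[cite: Connes1999, §VII eq. (3)] -/
def idelesModOne : Subgroup (SemilocalIdele p) where
  carrier := {x | modIdele p x = 1}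
  one_mem' := modIdele_one p
  mul_mem' := by
    intro x y hx hy
    simp only [Set.mem_setOf_eq] at hx hy ⊢
    rw [modIdele_mul, hx, hy, one_mul]
  inv_mem' := by
    intro x hx
    simp only [Set.mem_setOf_eq] at hx ⊢
    rw [modIdele_inv, hx, inv_one]

/-- `Γ_S ≤ J_S^1`: the diagonal `S`-units have module `1` (product formula; Connes 1999 §VII: "`O_S^*` …
is cocompact in `J_S^1`" — cocompactness NOT proved here). [cite: Connes1999, §VII eqs. (1)–(3)] -/
theorem map_diagUnits_sUnits_le (hinj : Function.Injective p) :
    (sUnits (Set.range p)).map (diagUnits p) ≤ idelesModOne p := by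
  rintro x ⟨u, hu, rfl⟩
  exact modIdele_diagUnits_eq_one p hinj hu

/-- **`K_S := ker Mod_S ⊂ C_S`** (Letter §7.4: "`C_S` … is (non-canonically) isomorphic to `ℝ_+^* × K_S`,
where `K_S` is the kernel of `Mod_S`"): the image of `J_S^1` in `C_S = J_S/Γ_S` (`Mod_S` factors through
`C_S` by `map_diagUnits_sUnits_le`).  The splitting `C_S ≅ ℝ_+^* × K_S` is PROVED below through the
archimedean section (`existsUnique_archSection_mul_kerMod`, `archSection_mul_injective`); the compactness of
`K_S` is NOT proved here. [cite: Connes2026Letter, §7.4 (arXiv p0025:L36)] -/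
def kerMod : Subgroup (ideleClassGroup p) :=
  (idelesModOne p).map (QuotientGroup.mk' _)

/-- **`Mod_S` on `C_S`**, well defined since `Mod_S(Γ_S) = 1`. [cite: Connes2026Letter, §7.4, display defining Mod_S on C_S (arXiv p0025:L33)] -/
def modClass (hinj : Function.Injective p) : ideleClassGroup p → ℝ :=
  fun x => Quotient.liftOn' x (modIdele p) fun a b hab => by
    rw [QuotientGroup.leftRel_apply] at hab
    have h1 : modIdele p (a⁻¹ * b) = 1 := map_diagUnits_sUnits_le p hinj hab
    rw [modIdele_mul, modIdele_inv] at h1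
    have ha := (modIdele_pos p a).ne'
    field_simp at h1
    linarith

/-- `Mod_S` of the class of an idele. [cite: Connes2026Letter, §7.4, display defining Mod_S on C_S (arXiv p0025:L33)] -/
theorem modClass_mk (hinj : Function.Injective p) (x : SemilocalIdele p) :
    modClass p hinj (QuotientGroup.mk x) = modIdele p x := rfl

/-- `K_S` is exactly the kernel of `Mod_S` on `C_S`. [cite: Connes2026Letter, §7.4 (arXiv p0025:L36)] -/
theorem mem_kerMod_iff (hinj : Function.Injective p) (x : ideleClassGroup p) :
    x ∈ kerMod p ↔ modClass p hinj x = 1 := by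
  constructor
  · rintro ⟨y, hy, rfl⟩
    exact hy
  · intro hx
    induction x using QuotientGroup.induction_on with
    | H y => exact ⟨y, hx, rfl⟩

/-! ### The splitting `C_S ≅ ℝ_+^* × K_S` (Letter §7.4) — PROVED via the archimedean section -/

/-- The archimedean idele `(r, 1, …, 1)`, `r ≠ 0` (the copy of `ℝ^*` in `GL₁(𝔸_S)` through the place `∞ ∈ S`).
[cite: Connes2026Letter, §7.4 (arXiv p0025:L36)] -/
def archIdele (r : ℝ) (hr : r ≠ 0) : SemilocalIdele p := (Units.mk0 r hr, 1)

/-- `Mod_S(r, 1, …, 1) = |r|`. [cite: Connes2026Letter, §7.4 (arXiv p0025:L33–L36)] -/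
theorem modIdele_archIdele (r : ℝ) (hr : r ≠ 0) : modIdele p (archIdele p r hr) = |r| := by
  simp [modIdele, archIdele]

/-- **The (non-canonical) section `ℝ^* → C_S`, `r ↦ [(r, 1, …, 1)]`** realising the splitting
"`C_S` … is (non-canonically) isomorphic to `ℝ_+^* × K_S`" of Letter §7.4 through the archimedean place.
[cite: Connes2026Letter, §7.4 (arXiv p0025:L36)] -/
def archSection (r : ℝ) (hr : r ≠ 0) : ideleClassGroup p := QuotientGroup.mk (archIdele p r hr)

omit [Fintype ι] in
/-- The section is multiplicative: `s(r r') = s(r) s(r')`. [cite: Connes2026Letter, §7.4 (arXiv p0025:L36)] -/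
theorem archSection_mul (r r' : ℝ) (hr : r ≠ 0) (hr' : r' ≠ 0) :
    archSection p (r * r') (mul_ne_zero hr hr') = archSection p r hr * archSection p r' hr' := by
  rw [archSection, archSection, archSection, ← QuotientGroup.mk_mul]
  congr 1
  ext <;> simp [archIdele]

/-- `Mod_S` is multiplicative on `C_S` ("modulated … group with module `Mod_S`"). [cite: Connes2026Letter, §7.4, display defining Mod_S on C_S (arXiv p0025:L33)] -/
theorem modClass_mul (hinj : Function.Injective p) (x y : ideleClassGroup p) :
    modClass p hinj (x * y) = modClass p hinj x * modClass p hinj y := by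
  induction x using QuotientGroup.induction_on with
  | H a =>
    induction y using QuotientGroup.induction_on with
    | H b => rw [← QuotientGroup.mk_mul, modClass_mk, modClass_mk, modClass_mk, modIdele_mul]

/-- `Mod_S(1) = 1` on `C_S`. [cite: Connes2026Letter, §7.4, display defining Mod_S on C_S (arXiv p0025:L33)] -/
theorem modClass_one (hinj : Function.Injective p) : modClass p hinj 1 = 1 := by
  rw [← QuotientGroup.mk_one, modClass_mk, modIdele_one]

/-- `Mod_S > 0` on `C_S`. [cite: Connes2026Letter, §7.4, display defining Mod_S on C_S (arXiv p0025:L33)] -/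
theorem modClass_pos (hinj : Function.Injective p) (x : ideleClassGroup p) : 0 < modClass p hinj x := by
  induction x using QuotientGroup.induction_on with
  | H a => rw [modClass_mk]; exact modIdele_pos p a

/-- `Mod_S(x⁻¹) = Mod_S(x)⁻¹` on `C_S`. [cite: Connes2026Letter, §7.4, display defining Mod_S on C_S (arXiv p0025:L33)] -/
theorem modClass_inv (hinj : Function.Injective p) (x : ideleClassGroup p) :
    modClass p hinj x⁻¹ = (modClass p hinj x)⁻¹ := by
  have h := modClass_mul p hinj x x⁻¹
  rw [mul_inv_cancel, modClass_one] at h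
  exact eq_inv_of_mul_eq_one_right h.symm

/-- `Mod_S(s(r)) = |r|`: the module is onto `ℝ_+^*` (because `∞ ∈ S`; this is why `2 log′Λ = 2 log Λ`
in Connes 1999 Thm VII.4, cf. `connesSemilocalGeometricSide`). [cite: Connes2026Letter, §7.4 (arXiv p0025:L33–L36)] -/
theorem modClass_archSection (hinj : Function.Injective p) (r : ℝ) (hr : r ≠ 0) :
    modClass p hinj (archSection p r hr) = |r| := by
  rw [archSection, modClass_mk, modIdele_archIdele]

/-- Every positive real is a module: `Mod_S : C_S → ℝ_+^*` is onto. [cite: Connes2026Letter, §7.4 (arXiv p0025:L33–L36)] -/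
theorem exists_modClass_eq (hinj : Function.Injective p) {r : ℝ} (hr : 0 < r) :
    ∃ x : ideleClassGroup p, modClass p hinj x = r :=
  ⟨archSection p r hr.ne', by rw [modClass_archSection, abs_of_pos hr]⟩

/-- `s(r) ∈ K_S` iff `|r| = 1`: the section meets `K_S` only in `s(±1)`. [cite: Connes2026Letter, §7.4 (arXiv p0025:L36)] -/
theorem archSection_mem_kerMod_iff (hinj : Function.Injective p) (r : ℝ) (hr : r ≠ 0) :
    archSection p r hr ∈ kerMod p ↔ |r| = 1 := by
  rw [mem_kerMod_iff p hinj, modClass_archSection]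

/-- **The splitting `C_S = s(ℝ_+^*) · K_S`, uniquely** (Letter §7.4: "`C_S` … is (non-canonically) isomorphic to
`ℝ_+^* × K_S`, where `K_S` is the kernel of `Mod_S`"): every idele class `x` is `s(Mod_S(x)) · k` for a UNIQUE
`k ∈ K_S` (namely `k = s(Mod_S x)⁻¹ x`). PROVED. [cite: Connes2026Letter, §7.4 (arXiv p0025:L33–L36)] -/
theorem existsUnique_archSection_mul_kerMod (hinj : Function.Injective p) (x : ideleClassGroup p) :
    ∃! k : ideleClassGroup p,
      k ∈ kerMod p ∧ x = archSection p (modClass p hinj x) (modClass_pos p hinj x).ne' * k := by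
  refine ⟨(archSection p (modClass p hinj x) (modClass_pos p hinj x).ne')⁻¹ * x, ⟨?_, ?_⟩, ?_⟩
  · rw [mem_kerMod_iff p hinj, modClass_mul, modClass_inv, modClass_archSection,
      abs_of_pos (modClass_pos p hinj x), inv_mul_cancel₀ (modClass_pos p hinj x).ne']
  · rw [mul_inv_cancel_left]
  · rintro k ⟨-, hk⟩
    rw [eq_inv_mul_iff_mul_eq, ← hk]

/-- The decomposition map `(r, k) ↦ s(r) · k`, `r > 0`, `k ∈ K_S`, is injective (with
`existsUnique_archSection_mul_kerMod`: a bijection `ℝ_+^* × K_S ≃ C_S`, a group isomorphism since `s` and the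
inclusion are homomorphisms into the abelian `C_S`). PROVED. [cite: Connes2026Letter, §7.4 (arXiv p0025:L36)] -/
theorem archSection_mul_injective (hinj : Function.Injective p) {r r' : ℝ} (hr : 0 < r) (hr' : 0 < r')
    {k k' : ideleClassGroup p} (hk : k ∈ kerMod p) (hk' : k' ∈ kerMod p)
    (h : archSection p r hr.ne' * k = archSection p r' hr'.ne' * k') : r = r' ∧ k = k' := by
  have hm := congrArg (modClass p hinj) h
  rw [modClass_mul, modClass_mul, modClass_archSection, modClass_archSection,
    (mem_kerMod_iff p hinj k).mp hk, (mem_kerMod_iff p hinj k').mp hk', mul_one, mul_one,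
    abs_of_pos hr, abs_of_pos hr'] at hm
  subst hm
  exact ⟨rfl, by simpa [inv_mul_cancel_left] using congrArg (fun z => (archSection p r hr.ne')⁻¹ * z) h⟩

end Adelic


/-! ## §7.1 / §7.4: cutoff projections and the semilocal trace formula (Connes 1999, Theorem VII.4)

Hilbert-space side, `k = ℚ`, `S = {∞} ∪ P`, IN THE `K_S`-INVARIANT PICTURE.  The Letter (§7.4, last
sentence): "The trace formula in the form (weilqb) is the specialization of the general trace formula of
[Co-zeta] to the `K_S` invariant part."  Design (as in `SemilocalSoninSpace.lean`, "The pull-back"):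
`w_S : L²(Y_S) → L²(C_S)` is unitary ([CMbook] Prop. 2.30) and `K_S`-invariant functions on `C_S ≅ ℝ_+^* × K_S`
are functions of the module, so `L²(X_S)^{K_S} ≅ L²(ℝ_+^*, d^*u) ≅ L²(ℝ)_ev` unitarily (CC 2021 eq. (8), the map
`w_∞`); under this identification the cutoff `P_Λ` of Connes 1999 VII (12) ("`ξ(x) = 0 ∀ x, |x| > Λ`") is
the multiplication by `1_{[−Λ, Λ]}` (`cutoffProj Λ`), the Fourier transform `F` of `𝔸_S` (Connes 1999 §VII
Lemma 1 b)) is the pulled-back semilocal Fourier transform `𝔽_S = θ_S ∘ 𝔽_{e_ℝ} ∘ θ_S⁻¹`, `θ_S = ∏_{p∈P} θ_p`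
(`semilocalFourierOf P`; for `P = {p}` this is the tree's `ConnesConsani2021.semilocalFourier p`, CCM 2024
§4.2 Lemma (iii)), and for a `K_S`-invariant test function `h(j) = |j|_S^{-1/2} g(log |j|_S)` the operator
`U(h) = ∫ h(λ) U(λ) d^*λ` of VII (7) is CC's `ϑ(f)`, `f = g ∘ log` (the `|λ|^{1/2}` is absorbed by the
non-unitary `U(λ)ξ(x) = ξ(λ⁻¹x)` versus the unitary `ϑ`), i.e. the tree's bounded operator
`ConnesConsani2021.scalingOp g` (`ScalingOperator.lean`: `⟪ξ, ϑ(f)η⟫ = ∫ g(τ)⟨ξ|ϑ(e^τ)η⟩dτ`,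
`inner_scalingOp`).  Mathlib has no trace class: "`Trace(R_Λ U(h))`" is typed, by cyclicity
`Trace(R_Λ U(h)) = Trace(U(h) R_Λ)`, as the sum of the diagonal coefficients `Σ_i ⟪e_i, ϑ(f) R_Λ e_i⟫`
along an arbitrary Hilbert basis `(e_i)` of `L²(ℝ)_ev` (for a trace-class operator every such series
converges absolutely to the trace) — the same convention as `ArchimedeanTraceFormula.CC2021_thm_4_7`
(there with `HasSum` to the exact value; here with summability and an `o(1)` limit, as printed).
-/

section TraceFormula

/-- `[−Λ, Λ]` is measurable. [folklore] -/
private theorem measurableSet_cutoff (Λ : ℝ) : MeasurableSet (Icc (-Λ) Λ) := measurableSet_Icc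

/-- The cutoff on vectors: `ξ ↦ 1_{[−Λ,Λ]} ξ` in `L²(ℝ)`. [folklore] -/
private def cutoffFun (Λ : ℝ) (ξ : Lp ℂ 2 (volume : Measure ℝ)) : Lp ℂ 2 (volume : Measure ℝ) :=
  (MemLp.indicator (measurableSet_cutoff Λ) (Lp.memLp ξ)).toLp ((Icc (-Λ) Λ).indicator (ξ : ℝ → ℂ))

/-- `cutoffFun Λ ξ = 1_{[−Λ,Λ]} ξ` a.e. [folklore] -/
private theorem cutoffFun_coeFn (Λ : ℝ) (ξ : Lp ℂ 2 (volume : Measure ℝ)) :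
    (cutoffFun Λ ξ : ℝ → ℂ) =ᵐ[volume] (Icc (-Λ) Λ).indicator (ξ : ℝ → ℂ) :=
  MemLp.coeFn_toLp _

/-- Additivity of the cutoff. [folklore] -/
private theorem cutoffFun_add (Λ : ℝ) (ξ η : Lp ℂ 2 (volume : Measure ℝ)) :
    cutoffFun Λ (ξ + η) = cutoffFun Λ ξ + cutoffFun Λ η := by
  apply Lp.ext
  filter_upwards [cutoffFun_coeFn Λ (ξ + η), cutoffFun_coeFn Λ ξ, cutoffFun_coeFn Λ η,
    Lp.coeFn_add ξ η, Lp.coeFn_add (cutoffFun Λ ξ) (cutoffFun Λ η)] with x h1 h2 h3 h4 h5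
  rw [h5, h1, Pi.add_apply, h2, h3]
  by_cases hx : x ∈ Icc (-Λ) Λ
  · rw [Set.indicator_of_mem hx, Set.indicator_of_mem hx, Set.indicator_of_mem hx, h4, Pi.add_apply]
  · rw [Set.indicator_of_notMem hx, Set.indicator_of_notMem hx, Set.indicator_of_notMem hx, add_zero]

/-- Homogeneity of the cutoff. [folklore] -/
private theorem cutoffFun_smul (Λ : ℝ) (c : ℂ) (ξ : Lp ℂ 2 (volume : Measure ℝ)) :
    cutoffFun Λ (c • ξ) = c • cutoffFun Λ ξ := by
  apply Lp.ext
  filter_upwards [cutoffFun_coeFn Λ (c • ξ), cutoffFun_coeFn Λ ξ, Lp.coeFn_smul c ξ,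
    Lp.coeFn_smul c (cutoffFun Λ ξ)] with x h1 h2 h3 h4
  rw [h4, h1, Pi.smul_apply, h2]
  by_cases hx : x ∈ Icc (-Λ) Λ
  · rw [Set.indicator_of_mem hx, Set.indicator_of_mem hx, h3, Pi.smul_apply]
  · rw [Set.indicator_of_notMem hx, Set.indicator_of_notMem hx, smul_zero]

/-- The cutoff does not increase the norm. [folklore] -/
private theorem norm_cutoffFun_le (Λ : ℝ) (ξ : Lp ℂ 2 (volume : Measure ℝ)) :
    ‖cutoffFun Λ ξ‖ ≤ ‖ξ‖ := by
  rw [cutoffFun, Lp.norm_toLp, Lp.norm_def]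
  exact ENNReal.toReal_mono (Lp.eLpNorm_ne_top ξ) (eLpNorm_indicator_le _)

/-- **The infrared cutoff `P_Λ`** (Connes 1999 VII (12): "the orthogonal projection onto the subspace
`{ξ ∈ L²(X_S) ; ξ(x) = 0 ∀ x, |x| > Λ}` … `P_Λ` is the multiplication operator by the function `ρ_Λ`",
`ρ_Λ = 1_{|x| ≤ Λ}`; Letter §7.1: `P_T`, "limitation in time to the interval `[−T, T]`"), in the
`K_S`-invariant picture `L²(ℝ)`: multiplication by the indicator of `[−Λ, Λ]`, a bounded operator of norm `≤ 1`
(an orthogonal projection: `cutoffProj_mul_self`, `inner_cutoffProj_left`, range `cutoffProj_eq_self_iff`).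
Dictionary: CC 2021's `P = 1 − 𝒫_1` ("multiplication by the characteristic function of `|x| ≥ 1`", §4 p. 15)
on plain functions is `ConnesConsani2021.cutoffP` (`SchwartzKernels.lean`, seat t1); here `𝒫_Λ` for every `Λ`,
on `L²` classes. [cite: Connes1999, §VII eq. (12); Connes2026Letter, §7.1 (arXiv p0024:L24)] -/
def cutoffProj (Λ : ℝ) : Lp ℂ 2 (volume : Measure ℝ) →L[ℂ] Lp ℂ 2 (volume : Measure ℝ) :=
  LinearMap.mkContinuous
    { toFun := cutoffFun Λ
      map_add' := cutoffFun_add Λ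
      map_smul' := cutoffFun_smul Λ }
    1 (fun ξ => by rw [one_mul]; exact norm_cutoffFun_le Λ ξ)

/-- `P_Λ ξ = 1_{[−Λ,Λ]} ξ` almost everywhere. [cite: Connes1999, §VII eq. (12)] -/
theorem cutoffProj_coeFn (Λ : ℝ) (ξ : Lp ℂ 2 (volume : Measure ℝ)) :
    (cutoffProj Λ ξ : ℝ → ℂ) =ᵐ[volume] (Icc (-Λ) Λ).indicator (ξ : ℝ → ℂ) :=
  cutoffFun_coeFn Λ ξ

/-- `‖P_Λ ξ‖ ≤ ‖ξ‖`. [cite: Connes1999, §VII eq. (12)] -/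
theorem norm_cutoffProj_le (Λ : ℝ) (ξ : Lp ℂ 2 (volume : Measure ℝ)) : ‖cutoffProj Λ ξ‖ ≤ ‖ξ‖ :=
  norm_cutoffFun_le Λ ξ

/-- `P_Λ` is idempotent (`1_I · 1_I = 1_I`): it is a projection. [cite: Connes1999, §VII eq. (12)] -/
theorem cutoffProj_mul_self (Λ : ℝ) : cutoffProj Λ * cutoffProj Λ = cutoffProj Λ := by
  ext ξ : 1
  change cutoffProj Λ (cutoffProj Λ ξ) = cutoffProj Λ ξ
  apply Lp.ext
  filter_upwards [cutoffProj_coeFn Λ (cutoffProj Λ ξ), cutoffProj_coeFn Λ ξ] with x h1 h2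
  rw [h1]
  by_cases hx : x ∈ Icc (-Λ) Λ
  · rw [Set.indicator_of_mem hx]
  · rw [Set.indicator_of_notMem hx, h2, Set.indicator_of_notMem hx]

/-- **The range of `P_Λ` is the subspace of VII (12)**: `P_Λ ξ = ξ` iff "`ξ(x) = 0 ∀ x, |x| > Λ`" (a.e.), i.e.
`P_Λ` is the projection ONTO `{ξ ∈ L² ; ξ = 0 off [−Λ, Λ]}`. PROVED. [cite: Connes1999, §VII eq. (12)] -/
theorem cutoffProj_eq_self_iff (Λ : ℝ) (ξ : Lp ℂ 2 (volume : Measure ℝ)) :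
    cutoffProj Λ ξ = ξ ↔ ∀ᵐ x : ℝ, x ∉ Icc (-Λ) Λ → (ξ : ℝ → ℂ) x = 0 := by
  constructor
  · intro h
    have hae : (cutoffProj Λ ξ : ℝ → ℂ) =ᵐ[volume] (ξ : ℝ → ℂ) := by rw [h]
    filter_upwards [hae, cutoffProj_coeFn Λ ξ] with x h1 h2 hx
    rw [← h1, h2, Set.indicator_of_notMem hx]
  · intro h
    apply Lp.ext
    filter_upwards [cutoffProj_coeFn Λ ξ, h] with x h1 h2
    rw [h1]
    by_cases hx : x ∈ Icc (-Λ) Λ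
    · rw [Set.indicator_of_mem hx]
    · rw [Set.indicator_of_notMem hx, h2 hx]

/-- **`P_Λ` is symmetric** (`⟪P_Λ ξ, η⟫ = ⟪ξ, P_Λ η⟫`): with idempotency, `P_Λ` is an ORTHOGONAL projection, as
stated in VII (12). PROVED. [cite: Connes1999, §VII eq. (12)] -/
theorem inner_cutoffProj_left (Λ : ℝ) (ξ η : Lp ℂ 2 (volume : Measure ℝ)) :
    ⟪cutoffProj Λ ξ, η⟫_ℂ = ⟪ξ, cutoffProj Λ η⟫_ℂ := by
  rw [L2.inner_def, L2.inner_def]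
  refine integral_congr_ae ?_
  filter_upwards [cutoffProj_coeFn Λ ξ, cutoffProj_coeFn Λ η] with x h1 h2
  rw [h1, h2]
  by_cases hx : x ∈ Icc (-Λ) Λ
  · rw [Set.indicator_of_mem hx, Set.indicator_of_mem hx]
  · rw [Set.indicator_of_notMem hx, Set.indicator_of_notMem hx, inner_zero_left, inner_zero_right]

/-- Mathlib's `L²` Fourier transform `𝔽_{e_ℝ}` as a bounded operator on `L²(ℝ)` (CC 2021 eq. (13)). [cite: ConnesConsani2021, eq. (13) p. 7] -/
def fourierL2 : Lp ℂ 2 (volume : Measure ℝ) →L[ℂ] Lp ℂ 2 (volume : Measure ℝ) :=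
  ((Lp.fourierTransformₗᵢ ℝ ℂ).toContinuousLinearEquiv :
    Lp ℂ 2 (volume : Measure ℝ) →L[ℂ] Lp ℂ 2 (volume : Measure ℝ))

/-- Its inverse `𝔽_{e_ℝ}⁻¹` as a bounded operator. [cite: ConnesConsani2021, eq. (13) p. 7] -/
def fourierL2Inv : Lp ℂ 2 (volume : Measure ℝ) →L[ℂ] Lp ℂ 2 (volume : Measure ℝ) :=
  ((Lp.fourierTransformₗᵢ ℝ ℂ).toContinuousLinearEquiv.symm :
    Lp ℂ 2 (volume : Measure ℝ) →L[ℂ] Lp ℂ 2 (volume : Measure ℝ))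

/-- `𝔽⁻¹ ∘ 𝔽 = 1` on `L²(ℝ)` (`F` "extends to a unitary operator", Connes 1999 §VII Lemma 1 b)). [cite: Connes1999, §VII Lemma 1 b)] -/
theorem fourierL2Inv_mul_fourierL2 : fourierL2Inv * fourierL2 = 1 := by
  ext ξ : 1
  exact (Lp.fourierTransformₗᵢ ℝ ℂ).toContinuousLinearEquiv.symm_apply_apply ξ

/-- `𝔽 ∘ 𝔽⁻¹ = 1` on `L²(ℝ)`. [cite: Connes1999, §VII Lemma 1 b)] -/
theorem fourierL2_mul_fourierL2Inv : fourierL2 * fourierL2Inv = 1 := by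
  ext ξ : 1
  exact (Lp.fourierTransformₗᵢ ℝ ℂ).toContinuousLinearEquiv.apply_symm_apply ξ

/-- The twist at one natural number: `θ_p = 1 − p^{-1/2} ϑ(p)` (`ConnesConsani2021.primeTwist`) if `p` is
prime, the identity otherwise (junk). [cite: ConnesConsaniMoscovici2024, §4.6 Lemma after Def. 4.5 (ii) p. 14] -/
def twistAt (n : ℕ) : Lp ℂ 2 (volume : Measure ℝ) →L[ℂ] Lp ℂ 2 (volume : Measure ℝ) :=
  if h : n.Prime then @primeTwist n ⟨h⟩ else 1

/-- For a prime, `twistAt p = θ_p`. [cite: ConnesConsaniMoscovici2024, §4.6 Lemma after Def. 4.5 (ii) p. 14] -/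
theorem twistAt_of_prime (q : ℕ) [hq : Fact q.Prime] : twistAt q = primeTwist q := by
  rw [twistAt, dif_pos hq.out]

/-- Each `θ_p` is invertible (`‖1 − θ_p‖ < 1`, `primeTwistUnit`). [cite: ConnesConsaniMoscovici2024, Thm. 4.6 §4.7 p. 15] -/
theorem isUnit_twistAt (n : ℕ) : IsUnit (twistAt n) := by
  unfold twistAt
  split_ifs with h
  · exact ⟨@primeTwistUnit n ⟨h⟩, @val_primeTwistUnit n ⟨h⟩⟩
  · exact isUnit_one

/-- **`θ_S = ∏_{p ∈ P} θ_p`** for `S = {∞} ∪ P` — the pull-back to `L²(ℝ)_ev` of CCM 2024's `θ_S(f) = σ_S ⊗ f`,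
whose Mellin symbol is `∏_{p∈S∖{∞}} (1 − p^{−1/2−is})` (CCM 2024 §4.6, Lemma after Def. 4.5 (ii), printed for
general finite `S`); the factors commute (all are functions of the scaling group), the product is taken
along the increasing enumeration of `P`. [cite: ConnesConsaniMoscovici2024, §4.6 Lemma after Def. 4.5 (ii) p. 14] -/
def twistProd (P : Finset ℕ) : Lp ℂ 2 (volume : Measure ℝ) →L[ℂ] Lp ℂ 2 (volume : Measure ℝ) :=
  ((P.sort (· ≤ ·)).map twistAt).prod

/-- `θ_∅ = 1` (`S = {∞}`: no twist). [cite: ConnesConsaniMoscovici2024, §4.6 Lemma after Def. 4.5 (ii) p. 14] -/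
theorem twistProd_empty : twistProd ∅ = 1 := by simp [twistProd]

/-- `θ_{{p}} = θ_p`: agreement with `SemilocalSoninSpace.lean` for `S = {∞, p}`. [cite: ConnesConsaniMoscovici2024, §4.6 Lemma after Def. 4.5 (ii) p. 14] -/
theorem twistProd_singleton (q : ℕ) [Fact q.Prime] : twistProd {q} = primeTwist q := by
  simp [twistProd, twistAt_of_prime]

/-- `θ_S` is invertible (a finite product of invertible operators). [cite: ConnesConsaniMoscovici2024, Thm. 4.6 §4.7 p. 15] -/
theorem isUnit_twistProd (P : Finset ℕ) : IsUnit (twistProd P) :=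
  List.prod_isUnit fun _ hm => by
    obtain ⟨n, -, rfl⟩ := List.mem_map.mp hm
    exact isUnit_twistAt n

/-- `θ_S` as a unit of the algebra of bounded operators. [cite: ConnesConsaniMoscovici2024, Thm. 4.6 §4.7 p. 15] -/
def twistProdUnit (P : Finset ℕ) : (Lp ℂ 2 (volume : Measure ℝ) →L[ℂ] Lp ℂ 2 (volume : Measure ℝ))ˣ :=
  (isUnit_twistProd P).unit

/-- The unit's value is `θ_S`. [cite: ConnesConsaniMoscovici2024, Thm. 4.6 §4.7 p. 15] -/
theorem val_twistProdUnit (P : Finset ℕ) :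
    (↑(twistProdUnit P) : Lp ℂ 2 (volume : Measure ℝ) →L[ℂ] Lp ℂ 2 (volume : Measure ℝ)) = twistProd P :=
  (isUnit_twistProd P).unit_spec

/-- `θ_S⁻¹ θ_S = 1`. [cite: ConnesConsaniMoscovici2024, Thm. 4.6 §4.7 p. 15] -/
theorem twistProdUnit_inv_mul (P : Finset ℕ) :
    (↑(twistProdUnit P)⁻¹ : Lp ℂ 2 (volume : Measure ℝ) →L[ℂ] Lp ℂ 2 (volume : Measure ℝ)) * twistProd P = 1 := by
  rw [← val_twistProdUnit, Units.inv_mul]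

/-- `θ_S θ_S⁻¹ = 1`. [cite: ConnesConsaniMoscovici2024, Thm. 4.6 §4.7 p. 15] -/
theorem twistProd_mul_inv (P : Finset ℕ) :
    twistProd P * (↑(twistProdUnit P)⁻¹ : Lp ℂ 2 (volume : Measure ℝ) →L[ℂ] Lp ℂ 2 (volume : Measure ℝ)) = 1 := by
  rw [← val_twistProdUnit, Units.mul_inv]

/-- **The pulled-back semilocal Fourier transform `𝔽_S := θ_S ∘ 𝔽_{e_ℝ} ∘ θ_S⁻¹` on `L²(ℝ)`**, `S = {∞} ∪ P`
(the conjugate of Mathlib's `L²` Fourier transform by `θ_S`; CCM 2024 §4.2 Lemma (iii) `𝔽_S ∘ η_S = η_S ∘ 𝔽_{e_ℝ}`;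
for `P = ∅` it is `𝔽_{e_ℝ}`, for `P = {p}` the tree's `semilocalFourier p`).  It stands for the Fourier
transform `F` of `𝔸_S` of Connes 1999 §VII Lemma 1 b) restricted to `K_S`-invariants; its Mellin symbol is the
unimodular `∏_p (1 − p^{−1/2−is})/(1 − p^{−1/2+is})` times that of `𝔽_{e_ℝ}` (unitarity not proved here).
[cite: Connes1999, §VII Lemma 1 b); ConnesConsaniMoscovici2024, §4.2 Lemma (iii) p. 12] -/
def semilocalFourierOf (P : Finset ℕ) : Lp ℂ 2 (volume : Measure ℝ) →L[ℂ] Lp ℂ 2 (volume : Measure ℝ) :=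
  twistProd P * fourierL2 * ↑(twistProdUnit P)⁻¹

/-- Its inverse `𝔽_S⁻¹ = θ_S ∘ 𝔽_{e_ℝ}⁻¹ ∘ θ_S⁻¹`. [cite: Connes1999, §VII Lemma 1 b)] -/
def semilocalFourierInvOf (P : Finset ℕ) :
    Lp ℂ 2 (volume : Measure ℝ) →L[ℂ] Lp ℂ 2 (volume : Measure ℝ) :=
  twistProd P * fourierL2Inv * ↑(twistProdUnit P)⁻¹

/-- `𝔽_S ∘ 𝔽_S⁻¹ = 1` (the Fourier transform of `𝔸_S` is invertible — unitary in print, Connes 1999 §VII Lemma 1 b)). [cite: Connes1999, §VII Lemma 1 b)] -/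
theorem semilocalFourierOf_mul_inv (P : Finset ℕ) :
    semilocalFourierOf P * semilocalFourierInvOf P = 1 := by
  calc semilocalFourierOf P * semilocalFourierInvOf P
      = twistProd P * fourierL2 * ((↑(twistProdUnit P)⁻¹ * twistProd P)) * fourierL2Inv *
          ↑(twistProdUnit P)⁻¹ := by
        simp only [semilocalFourierOf, semilocalFourierInvOf, mul_assoc]
    _ = 1 := by
        rw [twistProdUnit_inv_mul, mul_one, mul_assoc (twistProd P), fourierL2_mul_fourierL2Inv, mul_one,
          twistProd_mul_inv]

/-- `𝔽_S⁻¹ ∘ 𝔽_S = 1`. [cite: Connes1999, §VII Lemma 1 b)] -/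
theorem semilocalFourierInvOf_mul (P : Finset ℕ) :
    semilocalFourierInvOf P * semilocalFourierOf P = 1 := by
  calc semilocalFourierInvOf P * semilocalFourierOf P
      = twistProd P * fourierL2Inv * ((↑(twistProdUnit P)⁻¹ * twistProd P)) * fourierL2 *
          ↑(twistProdUnit P)⁻¹ := by
        simp only [semilocalFourierOf, semilocalFourierInvOf, mul_assoc]
    _ = 1 := by
        rw [twistProdUnit_inv_mul, mul_one, mul_assoc (twistProd P), fourierL2Inv_mul_fourierL2, mul_one,
          twistProd_mul_inv]

/-- For `S = {∞}`: `𝔽_∅ = 𝔽_{e_ℝ}` (the archimedean case, Letter §7.1). [cite: Connes2026Letter, §7.1 (arXiv p0024:L24)] -/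
theorem semilocalFourierOf_empty : semilocalFourierOf ∅ = fourierL2 := by
  have h1 : twistProdUnit ∅ = 1 := Units.ext (by rw [val_twistProdUnit, twistProd_empty, Units.val_one])
  rw [semilocalFourierOf, h1, inv_one, Units.val_one, mul_one, twistProd_empty, one_mul]

/-- For `S = {∞}`: `𝔽_∅⁻¹ = 𝔽_{e_ℝ}⁻¹`. [cite: Connes2026Letter, §7.1 (arXiv p0024:L24)] -/
theorem semilocalFourierInvOf_empty : semilocalFourierInvOf ∅ = fourierL2Inv := by
  have h1 : twistProdUnit ∅ = 1 := Units.ext (by rw [val_twistProdUnit, twistProd_empty, Units.val_one])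
  rw [semilocalFourierInvOf, h1, inv_one, Units.val_one, mul_one, twistProd_empty, one_mul]

/-- For `S = {∞, p}`: `𝔽_{{p}}` is the tree's `semilocalFourier p` (`θ_p ∘ 𝓕 ∘ θ_p⁻¹`). [cite: ConnesConsaniMoscovici2024, §4.2 Lemma (iii) p. 12] -/
theorem semilocalFourierOf_singleton (q : ℕ) [Fact q.Prime] :
    semilocalFourierOf {q} = semilocalFourier q := by
  have hval : (↑(twistProdUnit {q}) : Lp ℂ 2 (volume : Measure ℝ) →L[ℂ] Lp ℂ 2 (volume : Measure ℝ))
      = primeTwist q := by rw [val_twistProdUnit, twistProd_singleton]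
  have hE : ((primeTwistEquiv q : Lp ℂ 2 (volume : Measure ℝ) ≃L[ℂ] Lp ℂ 2 (volume : Measure ℝ)) :
      Lp ℂ 2 (volume : Measure ℝ) →L[ℂ] Lp ℂ 2 (volume : Measure ℝ)) = primeTwist q :=
    ContinuousLinearMap.ext (primeTwistEquiv_apply q)
  -- the inverse of the unit is the inverse of the equivalence
  have hinv : (↑(twistProdUnit {q})⁻¹ : Lp ℂ 2 (volume : Measure ℝ) →L[ℂ] Lp ℂ 2 (volume : Measure ℝ))
      = ((primeTwistEquiv q).symm : Lp ℂ 2 (volume : Measure ℝ) →L[ℂ] Lp ℂ 2 (volume : Measure ℝ)) := by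
    apply Units.inv_eq_of_mul_eq_one_left
    rw [hval, ← hE]
    exact (primeTwistEquiv q).coe_symm_comp_coe
  rw [semilocalFourierOf, hinv, twistProd_singleton, ← hE]
  rfl

/-- **The ultraviolet cutoff `P̂_Λ = F P_Λ F⁻¹`** (Connes 1999 VII, before (13); Letter §7.1/§7.4: `P̂_W`,
`P̂_W^S`, "limitation in frequency"), with `F = 𝔽_S` the (pulled-back) Fourier transform of `𝔸_S`.
[cite: Connes1999, §VII eq. (13); Connes2026Letter, §7.4, semilocal trace formula display (arXiv p0025:L16)] -/
def dualCutoffProj (P : Finset ℕ) (Λ : ℝ) :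
    Lp ℂ 2 (volume : Measure ℝ) →L[ℂ] Lp ℂ 2 (volume : Measure ℝ) :=
  semilocalFourierOf P * cutoffProj Λ * semilocalFourierInvOf P

/-- **The cutoff `R_Λ = P̂_Λ P_Λ`** (Connes 1999 VII (13)). [cite: Connes1999, §VII eq. (13)] -/
def cutoffR (P : Finset ℕ) (Λ : ℝ) : Lp ℂ 2 (volume : Measure ℝ) →L[ℂ] Lp ℂ 2 (volume : Measure ℝ) :=
  dualCutoffProj P Λ * cutoffProj Λ

/-- **The archimedean instance `S = {∞}`**: `P̂_Λ = 𝔽_{e_ℝ} P_Λ 𝔽_{e_ℝ}⁻¹` (Connes 1999 §V for `K = ℝ`;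
Letter §7.1 `P̂_W`, "its conjugate by the Fourier transform `𝔽_{e_ℝ}`", §7.6). [cite: Connes1999, §V eqs. (15)–(16); Connes2026Letter, §7.1 (arXiv p0024:L24)] -/
theorem dualCutoffProj_empty (Λ : ℝ) : dualCutoffProj ∅ Λ = fourierL2 * cutoffProj Λ * fourierL2Inv := by
  rw [dualCutoffProj, semilocalFourierOf_empty, semilocalFourierInvOf_empty]

/-- **The archimedean instance `S = {∞}`**: `R_Λ = 𝔽_{e_ℝ} P_Λ 𝔽_{e_ℝ}⁻¹ P_Λ`, the cutoff of Connes 1999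
Thm V.3 for `K = ℝ` (on `L²(ℝ)`; its even part is `L²(X_{{∞}})`). [cite: Connes1999, §V eqs. (15)–(16), Thm V.3] -/
theorem cutoffR_empty (Λ : ℝ) : cutoffR ∅ Λ = fourierL2 * cutoffProj Λ * fourierL2Inv * cutoffProj Λ := by
  rw [cutoffR, dualCutoffProj_empty]

/-- The diagonal coefficient `⟨e | ϑ(f) A e⟩` of `U(h) A` at a vector `e ∈ L²(ℝ)` (`f = g ∘ log`; a term of
`Trace(U(h) A)`). [cite: Connes1999, §VII eq. (7) and Thm 4] -/
def diagCoeff (g : ℝ → ℂ) (A : Lp ℂ 2 (volume : Measure ℝ) →L[ℂ] Lp ℂ 2 (volume : Measure ℝ))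
    (e : Lp ℂ 2 (volume : Measure ℝ)) : ℂ :=
  ⟪e, scalingOp g (A e)⟫_ℂ

/-- The diagonal coefficient as the printed integral `∫ g(τ) ⟨e | ϑ(e^τ) A e⟩ dτ` (tree:
`ConnesConsani2021.inner_scalingOp`), for `g ∈ L¹`. [cite: ConnesConsani2021, Prop. 2.2 (iii) p. 10 (proof)] -/
theorem diagCoeff_eq_integral {g : ℝ → ℂ} (hg : Integrable g)
    (A : Lp ℂ 2 (volume : Measure ℝ) →L[ℂ] Lp ℂ 2 (volume : Measure ℝ)) (e : Lp ℂ 2 (volume : Measure ℝ)) :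
    diagCoeff g A e = ∫ τ, g τ * scalingCoeff (e : ℝ → ℂ) ((A e : Lp ℂ 2 (volume : Measure ℝ)) : ℝ → ℂ) τ :=
  inner_scalingOp hg e (A e)

/-- **Connes 1999, Theorem VII.4 — the `S`-local trace formula — for `k = ℚ`, `S = {∞} ∪ P`, on
`K_S`-invariant test functions, in the `K_S`-invariant picture `L²(X_S)^{K_S} ≅ L²(ℝ)_ev`** (NAMED FACT, no proof
claimed).  As printed (Selecta Math. 5 (1999) §VII, Theorem 4): "Let `A_S` be as above, with basic character
`α = ∏ α_v`. Let `h ∈ 𝒮(C_S)` have compact support. Then when `Λ → ∞`, one has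
`Trace(R_Λ U(h)) = 2h(1) log′Λ + Σ_{v∈S} ∫′_{k_v^*} h(u⁻¹)/|1−u| d^*u + o(1)`
where `2 log′Λ = ∫_{λ ∈ C_S, |λ| ∈ [Λ⁻¹,Λ]} d^*λ`, each `k_v^*` is embedded in `C_S` by the map `u → (1,1,…,u,…,1)`
and the principal value `∫′` is uniquely determined by the pairing with the unique distribution on `k_v` which
agrees with `du/|1−u|` for `u ≠ 1` and whose Fourier transform relative to `α_v` vanishes at `1`."
(`R_Λ = P̂_Λ P_Λ`, VII (13); `U(h) = ∫ h(g)U(g) dg`, VII (7).)  The Letter, §7.4 (display), records its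
`K_S`-invariant specialisation as `−Σ_{v∈S} W_v(f) = log(TW) f(1) + Trace(ϑ(f)(1 − P_T^S − P̂_W^S))`
("The trace formula in the form [of that display] is the specialization of the general trace formula of [Co-zeta] to
the `K_S` invariant part"; the two-cutoff EXACT identity is NOT typed here as a fact — its proof locus is not
in [Co-zeta], which proves the asymptotic form).

TYPED (module docstring "Design"; all dictionary steps are the tree's, `AdeleClassTraceFormula.lean`): for
every finite set `P` of primes, every test function `g` (the `K_S`-invariant `h(j) = |j|^{-1/2} g(log|j|_S)`,
so `h(1) = g(0)`, `U(h) = ϑ(g ∘ log)`) and every Hilbert basis `(e_i)` of the even subspace `L²(ℝ)_ev =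
evenPart`: the diagonal series `Σ_i ⟪e_i, ϑ(f) R_Λ e_i⟫` of `U(h) R_Λ` (`ϑ(f) = scalingOp g`,
`R_Λ = 𝔽_S P_Λ 𝔽_S⁻¹ P_Λ = cutoffR P Λ`) is summable for every `Λ > 0`, and its sum differs from the geometric side
`2 g(0) log Λ + Σ_{p ∈ P} ∫′_{ℚ_p^*} + ∫′_ℝ = connesSemilocalGeometricSide P Λ g` (whose local terms are the
tree's `connesLocalTerm`, `connesArchPV`, PROVED equal to `weilPrimeTerm`/`−weilArchTerm` there) by `o(1)` as
`Λ → ∞`.  RH-FREE literature (a theorem about cutoffs; WHAT IT IS NOT: it says nothing about positivity —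
the positivity of `Trace` arguments needs the global `Q_Λ` of Connes 1999 VIII (16), left open in print).
[cite: Connes1999, §VII Thm 4 (arXiv p0013:L1); Connes2026Letter, §7.4, semilocal trace formula display (arXiv p0025:L16, L37)] -/
def Connes1999_thm_VII_4_rat : Prop :=
  ∀ (P : Finset ℕ), (∀ p ∈ P, p.Prime) →
    ∀ g : ℝ → ℂ, IsWeilTest g →
      ∀ (ι : Type) (b : HilbertBasis ι ℂ (evenPart : Submodule ℂ (Lp ℂ 2 (volume : Measure ℝ)))),
        (∀ Λ : ℝ, 0 < Λ →
          Summable fun i => diagCoeff g (cutoffR P Λ) ((b i : evenPart) : Lp ℂ 2 (volume : Measure ℝ))) ∧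
        Tendsto (fun Λ : ℝ =>
            (∑' i, diagCoeff g (cutoffR P Λ) ((b i : evenPart) : Lp ℂ 2 (volume : Measure ℝ)))
              - connesSemilocalGeometricSide P Λ g)
          atTop (𝓝 0)

/-- **The archimedean instance `S = {∞}` of the fact, EXPLICIT** (= Connes 1999 Thm V.3 for `K = ℝ` on
even functions; the Letter's §7.1 in its printed asymptotic source form): for every test function `g` and
every Hilbert basis `(e_i)` of `L²(ℝ)_ev`, the diagonal series of `ϑ(f) 𝔽 P_Λ 𝔽⁻¹ P_Λ` is summable and its
sum is `2 g(0) log Λ + ∫′_ℝ = 2 g(0) log Λ + connesArchPV g + o(1)` — with `connesArchPV g = −weilArchTerm g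
= −W_∞(f)` PROVED in the tree (`connesArchPV_eq_neg_weilArchTerm`).  PROVED from `Connes1999_thm_VII_4_rat`
(the case `P = ∅`: `cutoffR_empty`, `connesSemilocalGeometricSide_empty`). [cite: Connes1999, §V Thm 3 and §VII Thm 4; Connes2026Letter, §7.1 (arXiv p0024:L24)] -/
theorem Connes1999_thm_VII_4_rat.archimedean (h : Connes1999_thm_VII_4_rat) (g : ℝ → ℂ)
    (hg : IsWeilTest g) (ι : Type)
    (b : HilbertBasis ι ℂ (evenPart : Submodule ℂ (Lp ℂ 2 (volume : Measure ℝ)))) :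
    (∀ Λ : ℝ, 0 < Λ →
      Summable fun i => diagCoeff g (fourierL2 * cutoffProj Λ * fourierL2Inv * cutoffProj Λ)
        ((b i : evenPart) : Lp ℂ 2 (volume : Measure ℝ))) ∧
    Tendsto (fun Λ : ℝ =>
        (∑' i, diagCoeff g (fourierL2 * cutoffProj Λ * fourierL2Inv * cutoffProj Λ)
            ((b i : evenPart) : Lp ℂ 2 (volume : Measure ℝ)))
          - (2 * (Real.log Λ : ℂ) * g 0 + connesArchPV g))
      atTop (𝓝 0) := by
  have h0 := h ∅ (by simp) g hg ι b
  simp only [cutoffR_empty, connesSemilocalGeometricSide_empty] at h0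
  exact h0

end TraceFormula

/-! ## §7.2: Theorem 7.1 of the Letter is Connes–Consani 2021, Theorem 1 — an ALIAS, no second fact -/

/-- **Letter, Theorem 7.1** (§7.2): "Let `g ∈ C_c^∞(ℝ_+^*)` have support in the interval `[2^{-1/2}, 2^{1/2}]`
and Fourier transform vanishing at `i/2` and `0`. Then the following inequality holds
`W_∞(g * g^*) ≥ Tr(ϑ(g) 𝔖 ϑ(g)^*)`" with `𝔖` the orthogonal projection onto Sonin's space `𝔖_1`, citing
[weilpos] = Connes–Consani 2021, Theorem 1.  This IS the tree's named fact
`ConnesConsani2021.WeilArchPositivity_soninTrace` (`ArchimedeanSoninTrace.lean`), whose typing of "support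
in `[2^{-1/2}, 2^{1/2}]`" is `tsupport g ⊆ [−(log 2)/2, (log 2)/2]` for the additive avatar, of "Fourier
transform vanishing at `i/2` and `0`" is `mulFourier g (I/2) = 0`, `mulFourier g 0 = 0`, and of the Sonin trace
is the finite-orthonormal-family form.  No second fact is introduced: this is `Iff.rfl`.
[cite: Connes2026Letter, Thm 7.1 §7.2 (arXiv p0024:L37); ConnesConsani2021, Thm. 1 (Intro p. 4)] -/
theorem letter_thm_7_1_iff :
    (∀ g : ℝ → ℂ, IsWeilTest g →
      tsupport g ⊆ Icc (-(Real.log 2 / 2)) (Real.log 2 / 2) →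
      mulFourier g (I / 2) = 0 → mulFourier g 0 = 0 →
      ∀ (n : ℕ) (ξ : Fin n → Lp ℂ 2 (volume : Measure ℝ)),
        Orthonormal ℂ ξ → (∀ i, ξ i ∈ soninSpace 1 1) →
          ∑ i, (soninTraceForm (weilConv g (weilReflect g)) (ξ i : ℝ → ℂ)).re
            ≤ (archW (weilConv g (weilReflect g))).re)
    ↔ WeilArchPositivity_soninTrace :=
  Iff.rfl

/-! ## §7.6: the prolate wave operator `PW_λ` (the displayed differential expression) -/

/-- **The prolate wave operator** `(PW_λ ψ)(q) = −∂((λ² − q²)∂)ψ(q) + (2πλq)² ψ(q)` (Letter §7.6 display;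
Slepian–Pollak), as a formal differential expression on functions `ℝ → ℝ` over the WHOLE line (the point of
[CM] = Connes–Moscovici 2022 is its self-adjoint extension to `L²(ℝ)`, commuting with `P_λ`, `P̂_λ`, whose
restriction to Sonin's space has negative spectrum matching the ultraviolet behaviour of the zeta zeros —
NOT typed: source not held, see the module docstring).  The same expression, on `(−λ, λ)`, is the
eigen-equation of the tree's `IsProlateFunction` (`prolateWaveExpr_eigen_iff`).
[cite: Connes2026Letter, §7.6, display defining PW_λ (arXiv p0026:L33)] -/
def prolateWaveExpr (lam : ℝ) (ψ : ℝ → ℝ) (q : ℝ) : ℝ :=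
  -(deriv (fun y ↦ (lam ^ 2 - y ^ 2) * deriv ψ y) q) + (2 * π * lam * q) ^ 2 * ψ q

/-- Dictionary with `ConnesProlateGuess.lean`: the eigen-equation of `IsProlateFunction lam n f` is
`PW_λ f = χ f` on `(−λ, λ)` for the expression `prolateWaveExpr`. [cite: Connes2026Letter, §7.6, display defining PW_λ (arXiv p0026:L33)] -/
theorem prolateWaveExpr_eigen_iff (lam : ℝ) (f : ℝ → ℝ) :
    (∃ χ : ℝ, ∀ x ∈ Ioo (-lam) lam, prolateWaveExpr lam f x = χ * f x) ↔
      ∃ χ : ℝ, ∀ x ∈ Ioo (-lam) lam,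
        -(deriv (fun y ↦ (lam ^ 2 - y ^ 2) * deriv f y) x) + (2 * π * lam * x) ^ 2 * f x = χ * f x :=
  Iff.rfl

/-- A prolate function of the tree satisfies `PW_λ h = χ h` on `(−λ, λ)`. [cite: ConnesConsaniMoscovici2025, §7 eq. (7.5)] -/
theorem IsProlateFunction.prolateWaveExpr_eq {lam : ℝ} {n : ℕ} {f : ℝ → ℝ}
    (hf : IsProlateFunction lam n f) :
    ∃ χ : ℝ, ∀ x ∈ Ioo (-lam) lam, prolateWaveExpr lam f x = χ * f x :=
  hf.eigen

end Literature.NumberTheory.Connes2026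

end
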